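import Literature.Geometry.Kaehler.ComplexTorusHodgeLieAlgebraRatProductFiniteKernelSplitting
import Literature.NumberTheory.Automorphic.LieSimpleAlmostSimple
import HarnessLib

/-!
# Moonen–Zarhin Lemma (3.6) ∕ Lemma (3.5), first step, for a factor whose Hodge group is ALMOST `ℚ`-SIMPLE: «the
# assumption that `Hg(X₂)` is `ℚ`-simple implies that `𝔥𝔤(X₂)` does not contain a proper algebraic Lie subalgebra …
# we then have `𝔥𝔤(X) = 𝔤₁ ⊕ 𝔤₃ ≅ 𝔥𝔤(X₁)` and `𝔥𝔤(X₂) ≅ 𝔤₃` … noting that `𝔤₁` and `𝔤₃` are algebraic Lie subalgebras»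

Layer `Literature/Geometry/Kaehler`, namespace `Literature.Geometry.Kaehler.ComplexTorus`; lane `lit-hodgefound` (Track 2
foundations library), Layer A3/A4; prover seat `lit-hodgefound-p17` (generation 43, self-proposed row g43-#1 = the gen-42
free pointer 2 «`Hg(X₂)` a `ℚ`-simple torus: MZ (3.6)'s hypothesis has no Lie-algebra surrogate beyond `dim_ℚ 𝒜(X₂) = 1`»).
THEOREMS ONLY (no definition, no instance, no notation, no named fact; D-0026 net debt 0).

THE HYPOTHESIS.  Moonen–Zarhin's «`Hg(X₂)` is a `ℚ`-simple algebraic torus» (Lemma (3.6)) and «`𝔥𝔤(X₂)` is `ℚ`-simple»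
(Lemma (3.5); Borovoi) enter their proofs through ONE property of the `ℚ`-group `Hg(X₂)`: it has no proper non-trivial
connected normal algebraic subgroup DEFINED OVER `ℚ` («`𝔥𝔤(X₂)` does not contain a proper algebraic Lie subalgebra»;
«`𝔤₁` and `𝔤₃` are algebraic Lie subalgebras of `𝔥𝔤(X)`»).  In the tree's model (complex points `Hg(X₂)(ℂ) ≤ SL(V₂ ⊗ ℂ)`,
the `ℚ`-structure carried by the rational Hodge Lie algebra `𝒜(X₂) = hodgeGroupLieRat Φ₂` with `Lie Hg(X₂)(ℂ) = 𝒜(X₂) ⊗ ℂ`)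
this is the hypothesis, called «`Hg(X₂)` ALMOST `ℚ`-SIMPLE» below,

  `(hQ)` every Zariski-connected `M ≤ Hg(X₂)(ℂ)`, normalised by `Hg(X₂)(ℂ)`, WHOSE LIE ALGEBRA IS DEFINED OVER `ℚ`
  (`Lie M` is the complex span of its rational points `{A ∈ M(ℚ) | A ⊗ 1 ∈ Lie M}`), is `{e}` or `Hg(X₂)(ℂ)`,

— the tree's «almost simple» hypothesis of p17's `ComplexTorusHodgeGroupProductDimensionSplitting` (g38-#2) with the extra
rationality clause, hence WEAKER: it is satisfied by `ℚ`-simple tori of any dimension (abelian Lie algebra!), by every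
`X₂` with `𝒜(X₂)` a `ℚ`-simple Lie algebra (§3, Malle–Testerman 7.9 (b): `Lie M` is an ideal, and a `ℚ`-form of an ideal of
`𝒜(X₂) ⊗ ℂ` is an ideal of `𝒜(X₂)`), in particular by every `X₂` with `dim_ℚ 𝒜(X₂) = 1` (§3), and by every `ℂ`-almost-simple
`Hg(X₂)(ℂ)`.

THE MECHANISM (Moonen–Zarhin's two sentences).  The kernel `K₂ = {t | (1 0; 0 t) ∈ Hg(X₁ × X₂)(ℂ)}` of the first
projection is an algebraic subgroup of `Hg(X₂)(ℂ)` normalised by `Hg(X₂)(ℂ)` (p17 g37/g38), and ITS LIE ALGEBRA IS DEFINED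
OVER `ℚ`: `Lie K₂ = 𝔤₂(ℚ) ⊗ ℂ`, `𝔤₂(ℚ) = {W | (0 0; 0 W) ∈ 𝒜(X₁ × X₂)}` (p17 g42-#1 `coe_lieAlgebraGL_hodgeGroupCProdInr_eq_span`,
Springer 11.2: «`Ker f` is defined over `F`»).  So under `(hQ)`: `K₂° = {e}` (then `K₂` is finite: `𝔤₂ = 0`,
`𝔥𝔤(X) = 𝔤₁ ⊕ 𝔤₃ ≅ 𝔥𝔤(X₁)`, `𝔥𝔤(X₂) ≅ 𝔤₃`) or `K₂ = Hg(X₂)(ℂ)` (then `Hg(X₁ × X₂) = Hg(X₁) × Hg(X₂)`) — §2.  The consequences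
of a finite `K₂` are the tree's gen-42 `ℚ`-dictionary, consumed BY NAME (§4): `𝒜(X₁ × X₂) ≃ₗ⁅ℚ⁆ 𝒜(X₁)`, `𝒜(X₁) ↠ 𝒜(X₂)`,
`𝒜(X₁) ≃ₗ⁅ℚ⁆ 𝔤₁ × 𝒜(X₂)` (reductive `𝒜(X₁)`), and for a polarised `X₁` and solvable `𝒜(X₂)` — the TORUS case of Lemma (3.6) —
an INJECTIVE `𝒜(X₂) ↪ 𝔷(𝒜(X₁)) = 𝒜(X₁) ∩ End⁰(X₁)` with central Rosati-antisymmetric endomorphism values («the center of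
`Hg(X₁)` contains an algebraic torus which is `ℚ`-isogenous to `Hg(X₂)`», read on the rational Lie algebras; Prop. (3.8)'s
«embedding of `k` into the center of `End⁰(X)`»).  New splitting criteria follow: an almost `ℚ`-simple factor SPLITS OFF every
factor with a smaller Hodge Lie algebra, and an almost `ℚ`-simple CM factor splits off every polarised `X₁` with
`dim_ℚ 𝔷(𝒜(X₁)) < dim_ℚ 𝒜(X₂)` (e.g. `𝒜(X₁) ∩ End⁰(X₁) = 0`).

## Sources, verbatim

* B. Moonen, Yu. G. Zarhin [MoonenZarhin1999LowDim], *Hodge classes on abelian varieties of low dimension*, Math. Ann. 315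
  (1999), §3 Lemma (3.6) (held `paper:arxiv-math_9901113` p0007 L13–L25): «Assume that the Hodge group `Hg(X₂)` is a
  `ℚ`-simple algebraic torus. (In particular `X₂` is of CM-type.) Write `X = X₁ × X₂`. If `Hg(X) ≠ Hg(X₁) × Hg(X₂)` then the
  center of `Hg(X₁)` contains an algebraic torus which is `ℚ`-isogenous to `Hg(X₂)`.  Suppose that `Hg(X) ≠ Hg(X₁) × Hg(X₂)`.
  The assumption that `Hg(X₂)` is `ℚ`-simple implies that `𝔥𝔤(X₂)` does not contain a proper algebraic Lie subalgebra. Using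
  the notations of (3.1) we then have that `𝔥𝔤(X) = 𝔤₁ ⊕ 𝔤₃ ≅ 𝔥𝔤(X₁)` and `𝔥𝔤(X₂) ≅ 𝔤₃`. This readily implies the lemma,
  noting that `𝔤₁` and `𝔤₃` are algebraic Lie subalgebras of `𝔥𝔤(X)`.»; Lemma (3.5), proof (p0006 L115–p0007 L2): «the
  assumption that `𝔥𝔤(X₂)` is `ℚ`-simple implies that `𝔥𝔤(X) = 𝔤₁ ⊕ 𝔤₃ ≅ 𝔥𝔤(X₁)` and `𝔥𝔤(X₂) ≅ 𝔤₃`»; Remark (3.4bis)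
  (p0007 L9–L11): «It was shown by Borovoi that `𝔥𝔤(X)` is `ℚ`-simple if `End⁰(X) = ℚ`»; §3 (3.1); Prop. (3.8).
* T. A. Springer [Springer1998], *Linear Algebraic Groups*, 2nd ed., §11.2.8 ∕ §12.1.6 («if `φ` is defined over `F` … the
  kernel of `φ` is an `F`-subgroup»), §11.1.1 (`F`-structures `V(F)`), 2.2.1 (identity component), 4.4.5–4.4.7
  (`dim Lie = dim`, `Lie G° = Lie G`), 1.8.2.
* G. Malle, D. Testerman [MalleTesterman2011], *Linear Algebraic Groups and Finite Groups of Lie Type*, Thm. 7.9 (b)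
  («If `H ⊆ G` is normal, then `Lie(H)` is an ideal in `Lie(G)`»).
* J. S. Milne [Milne2017], *Algebraic Groups*, Def. 19.7 (almost-simple).
* B. B. Gordon [Gordon1997], *A survey of the Hodge conjecture for abelian varieties*, §2.16 Proposition (Goursat).
* N. Bourbaki [Bourbaki1989LieGroups13], *Lie Groups and Lie Algebras*, Ch. I §3 no. 8 (extension of the base field).
* H. Lange [Lange2023AbelianVarietiesComplex], §7.2.2 Prop. 7.2.5, §7.2.3 Prop. 7.2.6, §5.5.

## What is proved (`X₁`, `X₂` arbitrary complex tori unless stated; `G₂ = Hg(X₂)(ℂ)` in `GL`, `K₂ = hodgeGroupCProdInr`)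

* §1 `coe_lieAlgebraGL_identityComponent_hodgeGroupCProdInr_eq_span` ∕ `…Inl…` (`Lie K₂° = Lie K₂` is the complex span of
  its rational points — «`𝔤₂` is an algebraic Lie subalgebra», defined over `ℚ`).
* §2 THE DICHOTOMY under `(hQ)`: **`identityComponent_hodgeGroupCProdInr_eq_bot_or_eq_of_almostQSimple`** (`K₂° = 1` or
  `K₂ = Hg(X₂)(ℂ)`), **`finite_hodgeGroupCProdInr_or_hodgeGroupC_prod_eq_blockDiagProd_of_almostQSimple`** (`K₂` finite or the
  product splits), `finite_hodgeGroupCProdInr_of_ne_of_almostQSimple`; the mirrors for an almost `ℚ`-simple `Hg(X₁)`.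
* §3 SOURCES OF `(hQ)`: `forall_eq_bot_or_eq_of_almostSimple` (`ℂ`-almost simple ⟹ almost `ℚ`-simple),
  **`forall_eq_bot_or_eq_of_isSimple_hodgeGroupLieRat`** (`𝒜(X₂)` a `ℚ`-SIMPLE Lie algebra ⟹ `(hQ)`; Borovoi's case
  `End⁰(X₂) = ℚ`), **`forall_eq_bot_or_eq_of_finrank_hodgeGroupLieRat_eq_one`** (`dim_ℚ 𝒜(X₂) = 1` ⟹ `(hQ)`: CM elliptic
  curves, rank-one tori), and the two engines `eq_bot_of_isZConnected_of_forall_map_ratCast_mem_lieAlgebraGL_imp_eq_zero`,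
  `eq_map_toGL_hodgeGroupC_of_isZConnected_of_forall_map_ratCast_mem_lieAlgebraGL`.
* §4 MOONEN–ZARHIN (3.6) ∕ (3.5) OVER `ℚ` for `Hg(X₁ × X₂) ≠ Hg(X₁) × Hg(X₂)` and `(hQ)`:
  **`nonempty_lieEquiv_hodgeGroupLieRat_prod_of_ne_of_almostQSimple`** (`𝒜(X) ≃ₗ⁅ℚ⁆ 𝒜(X₁)` — «`𝔥𝔤(X) = 𝔤₁ ⊕ 𝔤₃ ≅ 𝔥𝔤(X₁)`»),
  `exists_surjective_lieHom_hodgeGroupLieRat_of_ne_of_almostQSimple` (`𝒜(X₁) ↠ 𝒜(X₂)`),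
  `finrank_hodgeGroupLieRat_le_of_ne_of_almostQSimple`, **`hodgeGroupC_prod_eq_blockDiagProd_of_almostQSimple_of_finrank_lt`**
  (an almost `ℚ`-simple factor splits off every factor with smaller `dim_ℚ 𝒜`),
  **`exists_lieIdeal_nonempty_lieEquiv_prod_of_ne_of_almostQSimple`** (`𝒜(X₁) ≃ₗ⁅ℚ⁆ 𝔤₁ × 𝒜(X₂)` — «`𝔥𝔤(X₁) ≅ 𝔤₁ ⊕ 𝔤₃`,
  `𝔥𝔤(X₂) ≅ 𝔤₃`», reductive `𝒜(X₁)`), `nonempty_hodgeGroupLieRat_lieEquiv_of_isSimple_of_ne_of_almostQSimple` (`𝒜(X₁)` simple ⟹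
  `𝒜(X₁) ≃ₗ⁅ℚ⁆ 𝒜(X₂)`), and the TORUS CASE (`X₁` polarised, `𝒜(X₂)` solvable):
  **`IsRiemannForm.exists_injective_lieHom_center_hodgeGroupLieRat_of_ne_of_almostQSimple`** (`𝒜(X₂) ↪ 𝔷(𝒜(X₁))`),
  `IsRiemannForm.finrank_hodgeGroupLieRat_le_finrank_center_of_ne_of_almostQSimple`,
  **`IsRiemannForm.exists_injective_linearMap_mem_endAlgRat_of_ne_of_almostQSimple`** (central Rosati-antisymmetric
  endomorphisms), **`IsRiemannForm.hodgeGroupC_prod_eq_blockDiagProd_of_almostQSimple_of_finrank_center_lt`**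
  (`dim_ℚ 𝔷(𝒜(X₁)) < dim_ℚ 𝒜(X₂)` ⟹ split; real points and the (D)-transfer).

NOT here: «`ℚ`-isogenous tori» as a statement about character groups (the tree has no `ℚ`-structure on `Hg` beyond the
rational Lie algebra); Ribet's Lemma (3.7) and the field embedding `k ↪ Z(End⁰(X₁))` of Prop. (3.8); the representation
theory of Lemmas (3.3)–(3.4).
-/

noncomputable section

open Matrix Module Function

namespace Literature.Geometry.Kaehler

namespace ComplexTorus

open Literature.NumberTheory.Automorphic (IsAlgebraicSubgroup IsZConnected identityComponent isZConnected_identityComponent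
  identityComponent_le lieAlgebraGL lieAlgebraGL_mono lieAlgebraGL_bot lieAlgebraGL_identityComponent isZConnected_bot
  map_conj_identityComponent_eq lie_mem_lieAlgebraGL_of_forall_conj_mem forall_conj_mem_of_forall_map_conj_eq)

/-! ### §0 Plumbing (file-local) -/

section Plumbing

variable {m : Type*} [Fintype m] [DecidableEq m]

omit [DecidableEq m] in
/-- `(A X − X A) ⊗ 1 = (A ⊗ 1)(X ⊗ 1) − (X ⊗ 1)(A ⊗ 1)`. [folklore] -/
private theorem map_ratCast_commutator₄₃ (A X : Matrix m m ℚ) :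
    (A * X - X * A).map ((↑) : ℚ → ℂ) = A.map ((↑) : ℚ → ℂ) * X.map ((↑) : ℚ → ℂ) - X.map ((↑) : ℚ → ℂ) * A.map ((↑) : ℚ → ℂ) := by
  rw [Matrix.map_sub _ Rat.cast_sub, show ((↑) : ℚ → ℂ) = (Rat.castHom ℂ : ℚ → ℂ) from rfl, Matrix.map_mul, Matrix.map_mul]

omit [Fintype m] [DecidableEq m] in
/-- `(q A) ⊗ 1 = q (A ⊗ 1)`. [folklore] -/
private theorem map_ratCast_smul₄₃ (q : ℚ) (A : Matrix m m ℚ) :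
    (q • A).map ((↑) : ℚ → ℂ) = (q : ℂ) • A.map ((↑) : ℚ → ℂ) := by
  ext i j
  simp [Matrix.map_apply]

/-- A Zariski-connected `H ≤ GL` with `Lie H = 0` is trivial (`dim H = dim Lie H = 0`; Springer 4.4.6, 1.8.2). [cite: Springer1998, 4.4.5–4.4.7 and 1.8.2] -/
private theorem eq_bot_of_lieAlgebraGL_eq_bot₄₃ {H : Subgroup (GL m ℂ)} (hH : IsZConnected H) (h : lieAlgebraGL H = ⊥) :
    H = ⊥ := by
  have h0 : hH.zdim = 0 := by rw [← hH.finrank_lieAlgebraGL_eq.2, h, finrank_bot]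
  have hb : (isZConnected_bot (n := m) (k := ℂ)).zdim = 0 := by
    rw [← (isZConnected_bot (n := m) (k := ℂ)).finrank_lieAlgebraGL_eq.2, lieAlgebraGL_bot, finrank_bot]
  exact ((isZConnected_bot (n := m) (k := ℂ)).eq_of_le_of_zdim_eq hH bot_le (hb.trans h0.symm)).symm

end Plumbing

/-! ### §1 `Lie K₂° = Lie K₂` and `Lie K₁° = Lie K₁` are defined over `ℚ` -/

section Kernels

variable {ι₁ ι₂ : Type*} [Fintype ι₁] [Fintype ι₂] [DecidableEq ι₁] [DecidableEq ι₂]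
  {E₁ E₂ : Type*} [NormedAddCommGroup E₁] [NormedSpace ℂ E₁] [NormedAddCommGroup E₂] [NormedSpace ℂ E₂]
  (Φ₁ : (ι₁ → ℝ) ≃L[ℝ] E₁) (Φ₂ : (ι₂ → ℝ) ≃L[ℝ] E₂)

/-- **`Lie K₂° IS DEFINED OVER ℚ`**: the Lie algebra of the identity component of `K₂ = {t | (1 0; 0 t) ∈ Hg(X₁ × X₂)(ℂ)}` is the
complex span of its own rational points (`Lie K₂° = Lie K₂ = 𝔤₂(ℚ) ⊗ ℂ`; «`𝔤₁` and `𝔤₃` are algebraic Lie subalgebras»).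
[cite: MoonenZarhin1999LowDim, §3 Lemma (3.6), proof] [cite: Springer1998, §11.2.8 and 4.4.5–4.4.7] -/
theorem coe_lieAlgebraGL_identityComponent_hodgeGroupCProdInr_eq_span :
    (lieAlgebraGL (identityComponent ((hodgeGroupCProdInr Φ₁ Φ₂).map Matrix.SpecialLinearGroup.toGL)) : Set (Matrix ι₂ ι₂ ℂ)) =
      Submodule.span ℂ ((fun A : Matrix ι₂ ι₂ ℚ ↦ A.map ((↑) : ℚ → ℂ)) ''
        {A : Matrix ι₂ ι₂ ℚ | A.map ((↑) : ℚ → ℂ) ∈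
          lieAlgebraGL (identityComponent ((hodgeGroupCProdInr Φ₁ Φ₂).map Matrix.SpecialLinearGroup.toGL))}) := by
  have hS : {W : Matrix ι₂ ι₂ ℚ | fromBlocks (0 : Matrix ι₁ ι₁ ℚ) 0 0 W ∈ hodgeGroupLieRat (prodPeriod Φ₁ Φ₂)} =
      {A : Matrix ι₂ ι₂ ℚ | A.map ((↑) : ℚ → ℂ) ∈ lieAlgebraGL ((hodgeGroupCProdInr Φ₁ Φ₂).map Matrix.SpecialLinearGroup.toGL)} :=
    Set.ext fun _ ↦ fromBlocks_zero_mem_hodgeGroupLieRat_prod_iff Φ₁ Φ₂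
  rw [lieAlgebraGL_identityComponent (isAlgebraicSubgroup_map_toGL_hodgeGroupCProdInr Φ₁ Φ₂),
    coe_lieAlgebraGL_hodgeGroupCProdInr_eq_span, hS]

/-- **`Lie K₁° IS DEFINED OVER ℚ`** (`K₁ = {s | (s 0; 0 1) ∈ Hg(X₁ × X₂)(ℂ)}`). [cite: MoonenZarhin1999LowDim, §3 Lemma (3.6), proof]
[cite: Springer1998, §11.2.8 and 4.4.5–4.4.7] -/
theorem coe_lieAlgebraGL_identityComponent_hodgeGroupCProdInl_eq_span :
    (lieAlgebraGL (identityComponent ((hodgeGroupCProdInl Φ₁ Φ₂).map Matrix.SpecialLinearGroup.toGL)) : Set (Matrix ι₁ ι₁ ℂ)) =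
      Submodule.span ℂ ((fun A : Matrix ι₁ ι₁ ℚ ↦ A.map ((↑) : ℚ → ℂ)) ''
        {A : Matrix ι₁ ι₁ ℚ | A.map ((↑) : ℚ → ℂ) ∈
          lieAlgebraGL (identityComponent ((hodgeGroupCProdInl Φ₁ Φ₂).map Matrix.SpecialLinearGroup.toGL))}) := by
  have hS : {W : Matrix ι₁ ι₁ ℚ | fromBlocks W 0 0 (0 : Matrix ι₂ ι₂ ℚ) ∈ hodgeGroupLieRat (prodPeriod Φ₁ Φ₂)} =
      {A : Matrix ι₁ ι₁ ℚ | A.map ((↑) : ℚ → ℂ) ∈ lieAlgebraGL ((hodgeGroupCProdInl Φ₁ Φ₂).map Matrix.SpecialLinearGroup.toGL)} :=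
    Set.ext fun _ ↦ fromBlocks_mem_hodgeGroupLieRat_prod_zero_iff Φ₁ Φ₂
  rw [lieAlgebraGL_identityComponent (isAlgebraicSubgroup_map_toGL_hodgeGroupCProdInl Φ₁ Φ₂),
    coe_lieAlgebraGL_hodgeGroupCProdInl_eq_span, hS]

end Kernels

/-! ### §3 (first, as it is used in §2's corollaries) Sources of the hypothesis «`Hg(X)` almost `ℚ`-simple» -/

section Sources

variable {ι : Type*} [Fintype ι] [DecidableEq ι] {E : Type*} [NormedAddCommGroup E] [NormedSpace ℂ E]
  (Φ : (ι → ℝ) ≃L[ℝ] E)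

/-- Rational points of `Lie M` for `M ≤ Hg(X)(ℂ)` lie in `𝒜(X)` (`A ⊗ 1 ∈ Lie M ⊆ Lie Hg(X)(ℂ) = 𝒜 ⊗ ℂ` and the rational points of
`𝒜 ⊗ ℂ` are `𝒜`). [cite: Springer1998, §11.1.1 (`V(F)`)] [cite: MoonenZarhin1999LowDim, §3 Lemma (3.6), proof] -/
theorem mem_hodgeGroupLieRat_of_map_ratCast_mem_lieAlgebraGL {M : Subgroup (GL ι ℂ)}
    (hle : M ≤ (hodgeGroupC Φ).map Matrix.SpecialLinearGroup.toGL) {A : Matrix ι ι ℚ}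
    (hA : A.map ((↑) : ℚ → ℂ) ∈ lieAlgebraGL M) : A ∈ hodgeGroupLieRat Φ :=
  (mem_hodgeGroupLieRat_iff_map_ratCast_mem_lieAlgebraGL Φ).2 (lieAlgebraGL_mono hle hA)

/-- **ENGINE 1: a Zariski-connected `M ≤ GL(V)(ℂ)` whose Lie algebra is defined over `ℚ` and has no non-zero rational point is
trivial** (`Lie M = span_ℂ ∅ = 0`, `dim M = dim Lie M = 0`). [cite: Springer1998, §11.1.1 and 4.4.5–4.4.7, 1.8.2] -/
theorem eq_bot_of_isZConnected_of_forall_map_ratCast_mem_lieAlgebraGL_imp_eq_zero {M : Subgroup (GL ι ℂ)} (hM : IsZConnected M)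
    (hdef : (lieAlgebraGL M : Set (Matrix ι ι ℂ)) =
      Submodule.span ℂ ((fun A : Matrix ι ι ℚ ↦ A.map ((↑) : ℚ → ℂ)) '' {A : Matrix ι ι ℚ | A.map ((↑) : ℚ → ℂ) ∈ lieAlgebraGL M}))
    (h0 : ∀ A : Matrix ι ι ℚ, A.map ((↑) : ℚ → ℂ) ∈ lieAlgebraGL M → A = 0) : M = ⊥ := by
  have hspan : Submodule.span ℂ ((fun A : Matrix ι ι ℚ ↦ A.map ((↑) : ℚ → ℂ)) ''
      {A : Matrix ι ι ℚ | A.map ((↑) : ℚ → ℂ) ∈ lieAlgebraGL M}) = ⊥ := by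
    refine Submodule.span_eq_bot.2 ?_
    rintro _ ⟨A, hA, rfl⟩
    rw [h0 A hA]
    exact Matrix.map_zero _ Rat.cast_zero
  exact eq_bot_of_lieAlgebraGL_eq_bot₄₃ hM (SetLike.coe_injective (hdef.trans (congrArg SetLike.coe hspan)))

/-- **ENGINE 2: a Zariski-connected `M ≤ Hg(X)(ℂ)` whose Lie algebra contains `𝒜(X) ⊗ 1` is `Hg(X)(ℂ)`** (`Lie Hg(X)(ℂ) = 𝒜 ⊗ ℂ ≤ Lie M`,
connected groups with the same Lie algebra coincide). [cite: Springer1998, 4.4.5–4.4.7 and 1.8.2] [cite: GreenGriffithsKerr2012, §II.C, Lemma after (II.C.1)] -/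
theorem eq_map_toGL_hodgeGroupC_of_isZConnected_of_forall_map_ratCast_mem_lieAlgebraGL {M : Subgroup (GL ι ℂ)}
    (hM : IsZConnected M) (hle : M ≤ (hodgeGroupC Φ).map Matrix.SpecialLinearGroup.toGL)
    (h : ∀ A ∈ hodgeGroupLieRat Φ, A.map ((↑) : ℚ → ℂ) ∈ lieAlgebraGL M) :
    M = (hodgeGroupC Φ).map Matrix.SpecialLinearGroup.toGL := by
  refine hM.eq_of_le_of_lieAlgebraGL_eq (isZConnected_map_toGL_hodgeGroupC Φ) hle (le_antisymm (lieAlgebraGL_mono hle) ?_)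
  intro Z hZ
  have hZ' : Z ∈ (lieAlgebraGL ((hodgeGroupC Φ).map Matrix.SpecialLinearGroup.toGL) : Set (Matrix ι ι ℂ)) := hZ
  rw [coe_lieAlgebraGL_hodgeGroupC_eq_span_hodgeGroupLieRat, SetLike.mem_coe] at hZ'
  refine (Submodule.span_le.2 ?_) hZ'
  rintro _ ⟨A, hA, rfl⟩
  exact h A hA

variable {Φ} in
/-- The rational points of `Lie M`, for `M ≤ Hg(X)(ℂ)` normalised by `Hg(X)(ℂ)`, form an IDEAL of the rational Hodge Lie algebra
`𝒜(X)` («if `H ⊆ G` is normal, then `Lie(H)` is an ideal in `Lie(G)`», and brackets of rational matrices are rational).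
[cite: MalleTesterman2011, Thm 7.9 (b)] [cite: Bourbaki1989LieGroups13, Ch. I §3 no. 8] -/
private theorem exists_lieIdeal_mem_iff_map_ratCast_mem_lieAlgebraGL {M : Subgroup (GL ι ℂ)}
    (hconj : ∀ g ∈ (hodgeGroupC Φ).map Matrix.SpecialLinearGroup.toGL, M.map (MulAut.conj g : GL ι ℂ →* GL ι ℂ) = M) :
    ∃ I : LieIdeal ℚ (hodgeGroupLieRat Φ),
      ∀ A : hodgeGroupLieRat Φ, A ∈ I ↔ (A : Matrix ι ι ℚ).map ((↑) : ℚ → ℂ) ∈ lieAlgebraGL M := by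
  letI : LieRing (Matrix ι ι ℚ) := LieRing.ofAssociativeRing
  letI : LieAlgebra ℚ (Matrix ι ι ℚ) := LieAlgebra.ofAssociativeAlgebra
  have hc := forall_conj_mem_of_forall_map_conj_eq hconj
  refine ⟨{ carrier := {A | (A : Matrix ι ι ℚ).map ((↑) : ℚ → ℂ) ∈ lieAlgebraGL M}
            add_mem' := fun {A B} hA hB ↦ by
              change ((A : Matrix ι ι ℚ) + B).map ((↑) : ℚ → ℂ) ∈ lieAlgebraGL M
              rw [Matrix.map_add _ Rat.cast_add]
              exact add_mem hA hB
            zero_mem' := by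
              change (0 : Matrix ι ι ℚ).map ((↑) : ℚ → ℂ) ∈ lieAlgebraGL M
              rw [Matrix.map_zero _ Rat.cast_zero]
              exact zero_mem _
            smul_mem' := fun q {A} hA ↦ by
              change (q • (A : Matrix ι ι ℚ)).map ((↑) : ℚ → ℂ) ∈ lieAlgebraGL M
              rw [map_ratCast_smul₄₃]
              exact Submodule.smul_mem _ _ hA
            lie_mem := fun {A X} hX ↦ by
              change ((⁅A, X⁆ : hodgeGroupLieRat Φ) : Matrix ι ι ℚ).map ((↑) : ℚ → ℂ) ∈ lieAlgebraGL M
              rw [LieSubalgebra.coe_bracket, Ring.lie_def, map_ratCast_commutator₄₃]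
              exact lie_mem_lieAlgebraGL_of_forall_conj_mem hc
                ((mem_hodgeGroupLieRat_iff_map_ratCast_mem_lieAlgebraGL Φ).1 A.2) hX }, fun A ↦ Iff.rfl⟩

/-- **`𝒜(X)` A `ℚ`-SIMPLE LIE ALGEBRA ⟹ `Hg(X)` ALMOST `ℚ`-SIMPLE**: every Zariski-connected `M ≤ Hg(X)(ℂ)` normalised by `Hg(X)(ℂ)`
whose Lie algebra is defined over `ℚ` is `{e}` or `Hg(X)(ℂ)` — the rational points of `Lie M` form an ideal of `𝒜(X)`, hence
are `0` (and `M = {e}` by Engine 1) or all of `𝒜(X)` (and `M = Hg(X)(ℂ)` by Engine 2).  Borovoi: `End⁰(X) = ℚ` ⟹ `𝔥𝔤(X)` is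
`ℚ`-simple. [cite: MoonenZarhin1999LowDim, §3 Lemma (3.5), proof, and Remark after (3.5) (Borovoi)] [cite: MalleTesterman2011, Thm 7.9 (b)]
[cite: Springer1998, 4.4.5–4.4.7 and 1.8.2] -/
theorem forall_eq_bot_or_eq_of_isSimple_hodgeGroupLieRat [LieAlgebra.IsSimple ℚ (hodgeGroupLieRat Φ)] :
    ∀ M : Subgroup (GL ι ℂ), IsZConnected M → M ≤ (hodgeGroupC Φ).map Matrix.SpecialLinearGroup.toGL →
      (∀ g ∈ (hodgeGroupC Φ).map Matrix.SpecialLinearGroup.toGL, M.map (MulAut.conj g : GL ι ℂ →* GL ι ℂ) = M) →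
        (lieAlgebraGL M : Set (Matrix ι ι ℂ)) = Submodule.span ℂ ((fun A : Matrix ι ι ℚ ↦ A.map ((↑) : ℚ → ℂ)) ''
          {A : Matrix ι ι ℚ | A.map ((↑) : ℚ → ℂ) ∈ lieAlgebraGL M}) →
          M = ⊥ ∨ M = (hodgeGroupC Φ).map Matrix.SpecialLinearGroup.toGL := by
  intro M hM hle hconj hdef
  obtain ⟨I, hI⟩ := exists_lieIdeal_mem_iff_map_ratCast_mem_lieAlgebraGL hconj
  rcases LieAlgebra.IsSimple.eq_bot_or_eq_top I with h | h
  · refine Or.inl (eq_bot_of_isZConnected_of_forall_map_ratCast_mem_lieAlgebraGL_imp_eq_zero hM hdef fun A hA ↦ ?_)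
    have hmem : (⟨A, mem_hodgeGroupLieRat_of_map_ratCast_mem_lieAlgebraGL Φ hle hA⟩ : hodgeGroupLieRat Φ) ∈ I := (hI _).2 hA
    rw [h, LieSubmodule.mem_bot] at hmem
    exact congrArg Subtype.val hmem
  · refine Or.inr (eq_map_toGL_hodgeGroupC_of_isZConnected_of_forall_map_ratCast_mem_lieAlgebraGL Φ hM hle fun A hA ↦ ?_)
    have hmem : (⟨A, hA⟩ : hodgeGroupLieRat Φ) ∈ I := by rw [h]; exact LieSubmodule.mem_top _
    exact (hI _).1 hmem

/-- **`dim_ℚ 𝒜(X) = 1` ⟹ `Hg(X)` ALMOST `ℚ`-SIMPLE** (rank-one tori: CM elliptic curves, `X` with `Hg(X) = U_k`; normality is not even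
needed): the rational points of `Lie M` form a `ℚ`-subspace of the line `𝒜(X)`. [cite: MoonenZarhin1999LowDim, §3 Lemma (3.6) and Prop. (3.8)]
[cite: Springer1998, 4.4.5–4.4.7 and 1.8.2] -/
theorem forall_eq_bot_or_eq_of_finrank_hodgeGroupLieRat_eq_one (h1 : finrank ℚ (hodgeGroupLieRat Φ) = 1) :
    ∀ M : Subgroup (GL ι ℂ), IsZConnected M → M ≤ (hodgeGroupC Φ).map Matrix.SpecialLinearGroup.toGL →
      (∀ g ∈ (hodgeGroupC Φ).map Matrix.SpecialLinearGroup.toGL, M.map (MulAut.conj g : GL ι ℂ →* GL ι ℂ) = M) →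
        (lieAlgebraGL M : Set (Matrix ι ι ℂ)) = Submodule.span ℂ ((fun A : Matrix ι ι ℚ ↦ A.map ((↑) : ℚ → ℂ)) ''
          {A : Matrix ι ι ℚ | A.map ((↑) : ℚ → ℂ) ∈ lieAlgebraGL M}) →
          M = ⊥ ∨ M = (hodgeGroupC Φ).map Matrix.SpecialLinearGroup.toGL := by
  intro M hM hle hconj hdef
  haveI := finite_hodgeGroupLieRat Φ
  obtain ⟨I, hI⟩ := exists_lieIdeal_mem_iff_map_ratCast_mem_lieAlgebraGL hconj
  -- the `ℚ`-subspace of rational points of `Lie M` inside the line `𝒜(X)`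
  let S : Submodule ℚ (hodgeGroupLieRat Φ) := I.toSubmodule
  have hS : ∀ A : hodgeGroupLieRat Φ, A ∈ S ↔ (A : Matrix ι ι ℚ).map ((↑) : ℚ → ℂ) ∈ lieAlgebraGL M :=
    fun A ↦ Iff.trans (LieSubmodule.mem_toSubmodule I) (hI A)
  have hle1 : finrank ℚ S ≤ 1 := (Submodule.finrank_le S).trans h1.le
  rcases Nat.le_one_iff_eq_zero_or_eq_one.1 hle1 with h0 | h1'
  · refine Or.inl (eq_bot_of_isZConnected_of_forall_map_ratCast_mem_lieAlgebraGL_imp_eq_zero hM hdef fun A hA ↦ ?_)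
    have hmem : (⟨A, mem_hodgeGroupLieRat_of_map_ratCast_mem_lieAlgebraGL Φ hle hA⟩ : hodgeGroupLieRat Φ) ∈ S := (hS _).2 hA
    rw [Submodule.finrank_eq_zero.1 h0, Submodule.mem_bot] at hmem
    exact congrArg Subtype.val hmem
  · refine Or.inr (eq_map_toGL_hodgeGroupC_of_isZConnected_of_forall_map_ratCast_mem_lieAlgebraGL Φ hM hle fun A hA ↦ ?_)
    have htop : S = ⊤ := Submodule.eq_top_of_finrank_eq (h1'.trans h1.symm)
    have hmem : (⟨A, hA⟩ : hodgeGroupLieRat Φ) ∈ S := by rw [htop]; exact Submodule.mem_top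
    exact (hS _).1 hmem

/-- `ℂ`-ALMOST SIMPLE ⟹ ALMOST `ℚ`-SIMPLE: the tree's hypothesis «every Zariski-connected `M ≤ Hg(X)(ℂ)` normalised by `Hg(X)(ℂ)`
is `{e}` or `Hg(X)(ℂ)`» (g38-#2) implies `(hQ)` — the rationality clause only weakens the hypothesis. [cite: Milne2017, Def 19.7]
[cite: MoonenZarhin1999LowDim, §3 Lemma (3.6), proof] -/
theorem forall_eq_bot_or_eq_of_almostSimple
    (hsimple : ∀ M : Subgroup (GL ι ℂ), IsZConnected M → M ≤ (hodgeGroupC Φ).map Matrix.SpecialLinearGroup.toGL →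
      (∀ g ∈ (hodgeGroupC Φ).map Matrix.SpecialLinearGroup.toGL, M.map (MulAut.conj g : GL ι ℂ →* GL ι ℂ) = M) →
        M = ⊥ ∨ M = (hodgeGroupC Φ).map Matrix.SpecialLinearGroup.toGL) :
    ∀ M : Subgroup (GL ι ℂ), IsZConnected M → M ≤ (hodgeGroupC Φ).map Matrix.SpecialLinearGroup.toGL →
      (∀ g ∈ (hodgeGroupC Φ).map Matrix.SpecialLinearGroup.toGL, M.map (MulAut.conj g : GL ι ℂ →* GL ι ℂ) = M) →
        (lieAlgebraGL M : Set (Matrix ι ι ℂ)) = Submodule.span ℂ ((fun A : Matrix ι ι ℚ ↦ A.map ((↑) : ℚ → ℂ)) ''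
          {A : Matrix ι ι ℚ | A.map ((↑) : ℚ → ℂ) ∈ lieAlgebraGL M}) →
          M = ⊥ ∨ M = (hodgeGroupC Φ).map Matrix.SpecialLinearGroup.toGL :=
  fun M hM hle hconj _ ↦ hsimple M hM hle hconj

end Sources

/-! ### §2 The dichotomy: `K₂° = 1` (finite kernel) or `K₂ = Hg(X₂)(ℂ)` (splitting), for `Hg(X₂)` almost `ℚ`-simple -/

section Dichotomy

variable {ι₁ ι₂ : Type*} [Fintype ι₁] [Fintype ι₂] [DecidableEq ι₁] [DecidableEq ι₂]
  {E₁ E₂ : Type*} [NormedAddCommGroup E₁] [NormedSpace ℂ E₁] [NormedAddCommGroup E₂] [NormedSpace ℂ E₂]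
  (Φ₁ : (ι₁ → ℝ) ≃L[ℝ] E₁) (Φ₂ : (ι₂ → ℝ) ≃L[ℝ] E₂)

section Right

variable
  (hQ : ∀ M : Subgroup (GL ι₂ ℂ), IsZConnected M → M ≤ (hodgeGroupC Φ₂).map Matrix.SpecialLinearGroup.toGL →
    (∀ g ∈ (hodgeGroupC Φ₂).map Matrix.SpecialLinearGroup.toGL, M.map (MulAut.conj g : GL ι₂ ℂ →* GL ι₂ ℂ) = M) →
      (lieAlgebraGL M : Set (Matrix ι₂ ι₂ ℂ)) = Submodule.span ℂ ((fun A : Matrix ι₂ ι₂ ℚ ↦ A.map ((↑) : ℚ → ℂ)) ''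
        {A : Matrix ι₂ ι₂ ℚ | A.map ((↑) : ℚ → ℂ) ∈ lieAlgebraGL M}) →
        M = ⊥ ∨ M = (hodgeGroupC Φ₂).map Matrix.SpecialLinearGroup.toGL)
include hQ

/-- **THE DICHOTOMY FOR AN ALMOST `ℚ`-SIMPLE `Hg(X₂)`: `K₂° = {e}` or `K₂ = Hg(X₂)(ℂ)`** — `K₂°` is Zariski-connected, normalised by
`Hg(X₂)(ℂ)`, and its Lie algebra `𝔤₂ ⊗ ℂ` is defined over `ℚ` (§1), so `(hQ)` applies («`𝔥𝔤(X₂)` does not contain a proper algebraic Lie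
subalgebra … `𝔤₁` and `𝔤₃` are algebraic Lie subalgebras»). [cite: MoonenZarhin1999LowDim, §3 Lemma (3.6), proof] [cite: Springer1998, 2.2.1 and §11.2.8]
[cite: Gordon1997, §2.16 Proposition] -/
theorem identityComponent_hodgeGroupCProdInr_eq_bot_or_eq_of_almostQSimple :
    identityComponent ((hodgeGroupCProdInr Φ₁ Φ₂).map Matrix.SpecialLinearGroup.toGL) = ⊥ ∨
      hodgeGroupCProdInr Φ₁ Φ₂ = hodgeGroupC Φ₂ := by
  have hK := isAlgebraicSubgroup_map_toGL_hodgeGroupCProdInr Φ₁ Φ₂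
  have hKle : (hodgeGroupCProdInr Φ₁ Φ₂).map Matrix.SpecialLinearGroup.toGL ≤
      (hodgeGroupC Φ₂).map Matrix.SpecialLinearGroup.toGL :=
    Subgroup.map_mono (hodgeGroupCProdInr_le_hodgeGroupC Φ₁ Φ₂)
  rcases hQ _ (isZConnected_identityComponent hK) ((identityComponent_le _).trans hKle)
      (fun g hg ↦ map_conj_identityComponent_hodgeGroupCProdInr_eq Φ₁ Φ₂ hg)
      (coe_lieAlgebraGL_identityComponent_hodgeGroupCProdInr_eq_span Φ₁ Φ₂) with h | h
  · exact Or.inl h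
  · refine Or.inr (Subgroup.map_injective Matrix.SpecialLinearGroup.toGL_injective (le_antisymm hKle ?_))
    rw [← h]
    exact identityComponent_le _

/-- **`Hg(X₂)` almost `ℚ`-simple ⟹ `K₂` is FINITE or `Hg(X₁ × X₂)(ℂ) = Hg(X₁)(ℂ) × Hg(X₂)(ℂ)`** (`𝔤₂ = 0`, i.e. `𝔥𝔤(X₂) ≅ 𝔤₃`, or
`𝔤₃ = 0`). [cite: MoonenZarhin1999LowDim, §3 Lemma (3.6), proof, and (3.1)] [cite: Gordon1997, §2.16 Proposition] -/
theorem finite_hodgeGroupCProdInr_or_hodgeGroupC_prod_eq_blockDiagProd_of_almostQSimple :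
    ((hodgeGroupCProdInr Φ₁ Φ₂ : Subgroup (SpecialLinearGroup ι₂ ℂ)) : Set (SpecialLinearGroup ι₂ ℂ)).Finite ∨
      hodgeGroupC (prodPeriod Φ₁ Φ₂) = blockDiagProd (hodgeGroupC Φ₁) (hodgeGroupC Φ₂) := by
  rcases identityComponent_hodgeGroupCProdInr_eq_bot_or_eq_of_almostQSimple Φ₁ Φ₂ hQ with h | h
  · exact Or.inl (finite_hodgeGroupCProdInr_of_identityComponent_eq_bot Φ₁ Φ₂ h)
  · exact Or.inr (hodgeGroupC_prod_eq_blockDiagProd_of_hodgeGroupCProdInr_eq Φ₁ Φ₂ h)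

/-- **Non-split with `Hg(X₂)` almost `ℚ`-simple ⟹ `K₂` finite** («we then have … `𝔥𝔤(X₂) ≅ 𝔤₃`», `𝔤₂ = 0`).
[cite: MoonenZarhin1999LowDim, §3 Lemma (3.6), proof] -/
theorem finite_hodgeGroupCProdInr_of_ne_of_almostQSimple
    (hne : hodgeGroupC (prodPeriod Φ₁ Φ₂) ≠ blockDiagProd (hodgeGroupC Φ₁) (hodgeGroupC Φ₂)) :
    ((hodgeGroupCProdInr Φ₁ Φ₂ : Subgroup (SpecialLinearGroup ι₂ ℂ)) : Set (SpecialLinearGroup ι₂ ℂ)).Finite :=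
  (finite_hodgeGroupCProdInr_or_hodgeGroupC_prod_eq_blockDiagProd_of_almostQSimple Φ₁ Φ₂ hQ).resolve_right hne

/-- The `∀`-form over `ℚ`: non-split with `Hg(X₂)` almost `ℚ`-simple ⟹ `𝔤₂(ℚ) = 0`, i.e. `(0 0; 0 W) ∈ 𝒜(X₁ × X₂) ⟹ W = 0`.
[cite: MoonenZarhin1999LowDim, §3 Lemma (3.6), proof] -/
theorem eq_zero_of_zero_fromBlocks_mem_of_ne_of_almostQSimple
    (hne : hodgeGroupC (prodPeriod Φ₁ Φ₂) ≠ blockDiagProd (hodgeGroupC Φ₁) (hodgeGroupC Φ₂)) {W : Matrix ι₂ ι₂ ℚ}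
    (hW : fromBlocks (0 : Matrix ι₁ ι₁ ℚ) 0 0 W ∈ hodgeGroupLieRat (prodPeriod Φ₁ Φ₂)) : W = 0 :=
  (finite_hodgeGroupCProdInr_iff_forall_zero_fromBlocks_mem_imp Φ₁ Φ₂).1
    (finite_hodgeGroupCProdInr_of_ne_of_almostQSimple Φ₁ Φ₂ hQ hne) W hW

end Right

section Left

variable
  (hQ : ∀ M : Subgroup (GL ι₁ ℂ), IsZConnected M → M ≤ (hodgeGroupC Φ₁).map Matrix.SpecialLinearGroup.toGL →
    (∀ g ∈ (hodgeGroupC Φ₁).map Matrix.SpecialLinearGroup.toGL, M.map (MulAut.conj g : GL ι₁ ℂ →* GL ι₁ ℂ) = M) →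
      (lieAlgebraGL M : Set (Matrix ι₁ ι₁ ℂ)) = Submodule.span ℂ ((fun A : Matrix ι₁ ι₁ ℚ ↦ A.map ((↑) : ℚ → ℂ)) ''
        {A : Matrix ι₁ ι₁ ℚ | A.map ((↑) : ℚ → ℂ) ∈ lieAlgebraGL M}) →
        M = ⊥ ∨ M = (hodgeGroupC Φ₁).map Matrix.SpecialLinearGroup.toGL)
include hQ

/-- **The mirror dichotomy for an almost `ℚ`-simple `Hg(X₁)`: `K₁° = {e}` or `K₁ = Hg(X₁)(ℂ)`.**
[cite: MoonenZarhin1999LowDim, §3 Lemma (3.6), proof] [cite: Springer1998, 2.2.1 and §11.2.8] [cite: Gordon1997, §2.16 Proposition] -/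
theorem identityComponent_hodgeGroupCProdInl_eq_bot_or_eq_of_almostQSimple :
    identityComponent ((hodgeGroupCProdInl Φ₁ Φ₂).map Matrix.SpecialLinearGroup.toGL) = ⊥ ∨
      hodgeGroupCProdInl Φ₁ Φ₂ = hodgeGroupC Φ₁ := by
  have hK := isAlgebraicSubgroup_map_toGL_hodgeGroupCProdInl Φ₁ Φ₂
  have hKle : (hodgeGroupCProdInl Φ₁ Φ₂).map Matrix.SpecialLinearGroup.toGL ≤
      (hodgeGroupC Φ₁).map Matrix.SpecialLinearGroup.toGL :=
    Subgroup.map_mono (hodgeGroupCProdInl_le_hodgeGroupC Φ₁ Φ₂)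
  rcases hQ _ (isZConnected_identityComponent hK) ((identityComponent_le _).trans hKle)
      (fun g hg ↦ map_conj_identityComponent_hodgeGroupCProdInl_eq Φ₁ Φ₂ hg)
      (coe_lieAlgebraGL_identityComponent_hodgeGroupCProdInl_eq_span Φ₁ Φ₂) with h | h
  · exact Or.inl h
  · refine Or.inr (Subgroup.map_injective Matrix.SpecialLinearGroup.toGL_injective (le_antisymm hKle ?_))
    rw [← h]
    exact identityComponent_le _

/-- **`Hg(X₁)` almost `ℚ`-simple ⟹ `K₁` is finite or the product splits.** [cite: MoonenZarhin1999LowDim, §3 Lemma (3.6), proof, and (3.1)]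
[cite: Gordon1997, §2.16 Proposition] -/
theorem finite_hodgeGroupCProdInl_or_hodgeGroupC_prod_eq_blockDiagProd_of_almostQSimple :
    ((hodgeGroupCProdInl Φ₁ Φ₂ : Subgroup (SpecialLinearGroup ι₁ ℂ)) : Set (SpecialLinearGroup ι₁ ℂ)).Finite ∨
      hodgeGroupC (prodPeriod Φ₁ Φ₂) = blockDiagProd (hodgeGroupC Φ₁) (hodgeGroupC Φ₂) := by
  rcases identityComponent_hodgeGroupCProdInl_eq_bot_or_eq_of_almostQSimple Φ₁ Φ₂ hQ with h | h
  · exact Or.inl (finite_hodgeGroupCProdInl_of_identityComponent_eq_bot Φ₁ Φ₂ h)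
  · exact Or.inr (hodgeGroupC_prod_eq_blockDiagProd_of_hodgeGroupCProdInl_eq Φ₁ Φ₂ h)

/-- Non-split with `Hg(X₁)` almost `ℚ`-simple ⟹ `K₁` finite. [cite: MoonenZarhin1999LowDim, §3 Lemma (3.6), proof] -/
theorem finite_hodgeGroupCProdInl_of_ne_of_almostQSimple
    (hne : hodgeGroupC (prodPeriod Φ₁ Φ₂) ≠ blockDiagProd (hodgeGroupC Φ₁) (hodgeGroupC Φ₂)) :
    ((hodgeGroupCProdInl Φ₁ Φ₂ : Subgroup (SpecialLinearGroup ι₁ ℂ)) : Set (SpecialLinearGroup ι₁ ℂ)).Finite :=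
  (finite_hodgeGroupCProdInl_or_hodgeGroupC_prod_eq_blockDiagProd_of_almostQSimple Φ₁ Φ₂ hQ).resolve_right hne

end Left

end Dichotomy

/-! ### §4 Moonen–Zarhin (3.6) ∕ (3.5) over `ℚ` for a non-split product with an almost `ℚ`-simple `Hg(X₂)` -/

section Consequences

variable {ι₁ ι₂ : Type*} [Fintype ι₁] [Fintype ι₂] [DecidableEq ι₁] [DecidableEq ι₂]
  {E₁ E₂ : Type*} [NormedAddCommGroup E₁] [NormedSpace ℂ E₁] [NormedAddCommGroup E₂] [NormedSpace ℂ E₂]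
  (Φ₁ : (ι₁ → ℝ) ≃L[ℝ] E₁) (Φ₂ : (ι₂ → ℝ) ≃L[ℝ] E₂)
  (hQ : ∀ M : Subgroup (GL ι₂ ℂ), IsZConnected M → M ≤ (hodgeGroupC Φ₂).map Matrix.SpecialLinearGroup.toGL →
    (∀ g ∈ (hodgeGroupC Φ₂).map Matrix.SpecialLinearGroup.toGL, M.map (MulAut.conj g : GL ι₂ ℂ →* GL ι₂ ℂ) = M) →
      (lieAlgebraGL M : Set (Matrix ι₂ ι₂ ℂ)) = Submodule.span ℂ ((fun A : Matrix ι₂ ι₂ ℚ ↦ A.map ((↑) : ℚ → ℂ)) ''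
        {A : Matrix ι₂ ι₂ ℚ | A.map ((↑) : ℚ → ℂ) ∈ lieAlgebraGL M}) →
        M = ⊥ ∨ M = (hodgeGroupC Φ₂).map Matrix.SpecialLinearGroup.toGL)
include hQ

/-- **«`𝔥𝔤(X) = 𝔤₁ ⊕ 𝔤₃ ≅ 𝔥𝔤(X₁)`» OVER `ℚ`**: for `Hg(X₂)` almost `ℚ`-simple and `Hg(X₁ × X₂) ≠ Hg(X₁) × Hg(X₂)`, the first block projection
is an isomorphism of rational Lie algebras `𝒜(X₁ × X₂) ≃ₗ⁅ℚ⁆ 𝒜(X₁)`. [cite: MoonenZarhin1999LowDim, §3 Lemma (3.6), proof ("`𝔥𝔤(X) = 𝔤₁ ⊕ 𝔤₃ ≅ 𝔥𝔤(X₁)`")]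
[cite: Gordon1997, §2.16 Proposition] -/
theorem nonempty_lieEquiv_hodgeGroupLieRat_prod_of_ne_of_almostQSimple
    (hne : hodgeGroupC (prodPeriod Φ₁ Φ₂) ≠ blockDiagProd (hodgeGroupC Φ₁) (hodgeGroupC Φ₂)) :
    Nonempty (hodgeGroupLieRat (prodPeriod Φ₁ Φ₂) ≃ₗ⁅ℚ⁆ hodgeGroupLieRat Φ₁) :=
  (finite_hodgeGroupCProdInr_iff_nonempty_lieEquiv_hodgeGroupLieRat Φ₁ Φ₂).1
    (finite_hodgeGroupCProdInr_of_ne_of_almostQSimple Φ₁ Φ₂ hQ hne)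

/-- **«`𝔥𝔤(X₂) ≅ 𝔤₃`», a QUOTIENT of `𝔥𝔤(X₁)`, OVER `ℚ`**: non-split with `Hg(X₂)` almost `ℚ`-simple ⟹ a surjective homomorphism of rational
Lie algebras `𝒜(X₁) ↠ 𝒜(X₂)`. [cite: MoonenZarhin1999LowDim, §3 Lemma (3.6), proof, and (3.1)] [cite: Gordon1997, §2.16 Proposition] -/
theorem exists_surjective_lieHom_hodgeGroupLieRat_of_ne_of_almostQSimple
    (hne : hodgeGroupC (prodPeriod Φ₁ Φ₂) ≠ blockDiagProd (hodgeGroupC Φ₁) (hodgeGroupC Φ₂)) :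
    ∃ φ : hodgeGroupLieRat Φ₁ →ₗ⁅ℚ⁆ hodgeGroupLieRat Φ₂, Surjective φ :=
  exists_surjective_lieHom_hodgeGroupLieRat_of_finite_hodgeGroupCProdInr Φ₁ Φ₂
    (finite_hodgeGroupCProdInr_of_ne_of_almostQSimple Φ₁ Φ₂ hQ hne)

/-- Non-split with `Hg(X₂)` almost `ℚ`-simple ⟹ `dim_ℚ 𝒜(X₂) ≤ dim_ℚ 𝒜(X₁)` (`dim Hg(X₂) ≤ dim Hg(X₁)`).
[cite: MoonenZarhin1999LowDim, §3 Lemma (3.6), proof] [cite: Springer1998, 4.4.5–4.4.7] -/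
theorem finrank_hodgeGroupLieRat_le_of_ne_of_almostQSimple
    (hne : hodgeGroupC (prodPeriod Φ₁ Φ₂) ≠ blockDiagProd (hodgeGroupC Φ₁) (hodgeGroupC Φ₂)) :
    finrank ℚ (hodgeGroupLieRat Φ₂) ≤ finrank ℚ (hodgeGroupLieRat Φ₁) :=
  finrank_hodgeGroupLieRat_le_of_finite_hodgeGroupCProdInr Φ₁ Φ₂ (finite_hodgeGroupCProdInr_of_ne_of_almostQSimple Φ₁ Φ₂ hQ hne)

/-- **AN ALMOST `ℚ`-SIMPLE FACTOR SPLITS OFF EVERY FACTOR WITH A SMALLER HODGE LIE ALGEBRA**: `Hg(X₂)` almost `ℚ`-simple and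
`dim_ℚ 𝒜(X₁) < dim_ℚ 𝒜(X₂)` ⟹ `Hg(X₁ × X₂)(ℂ) = Hg(X₁)(ℂ) × Hg(X₂)(ℂ)` (for a torus `Hg(X₂)` this is NOT covered by the simple-Lie-algebra
criteria of the tree). [cite: MoonenZarhin1999LowDim, §3 Lemma (3.6) and (3.1)] [cite: Gordon1997, §2.16 Proposition] [cite: Springer1998, 4.4.5–4.4.7] -/
theorem hodgeGroupC_prod_eq_blockDiagProd_of_almostQSimple_of_finrank_lt
    (hlt : finrank ℚ (hodgeGroupLieRat Φ₁) < finrank ℚ (hodgeGroupLieRat Φ₂)) :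
    hodgeGroupC (prodPeriod Φ₁ Φ₂) = blockDiagProd (hodgeGroupC Φ₁) (hodgeGroupC Φ₂) := by
  by_contra hne
  exact absurd (finrank_hodgeGroupLieRat_le_of_ne_of_almostQSimple Φ₁ Φ₂ hQ hne) (not_le.2 hlt)

/-- Real points: `Hg(X₂)` almost `ℚ`-simple and `dim_ℚ 𝒜(X₁) < dim_ℚ 𝒜(X₂)` ⟹ `Hg(X₁ × X₂)(ℝ) = Hg(X₁)(ℝ) × Hg(X₂)(ℝ)`.
[cite: MoonenZarhin1999LowDim, §3 Lemma (3.6) and (3.1)] -/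
theorem hodgeGroup_prod_eq_of_almostQSimple_of_finrank_lt
    (hlt : finrank ℚ (hodgeGroupLieRat Φ₁) < finrank ℚ (hodgeGroupLieRat Φ₂)) :
    hodgeGroup (prodPeriod Φ₁ Φ₂) = ((hodgeGroup Φ₁).prod (hodgeGroup Φ₂)).map (blockDiag ι₁ ι₂) :=
  hodgeGroup_prod_eq_of_hodgeGroupC_prod_eq (hodgeGroupC_prod_eq_blockDiagProd_of_almostQSimple_of_finrank_lt Φ₁ Φ₂ hQ hlt)

/-- **«`𝔥𝔤(X₁) ≅ 𝔤₁ ⊕ 𝔤₃`, `𝔥𝔤(X₂) ≅ 𝔤₃`» OVER `ℚ`**: for REDUCTIVE `𝒜(X₁)` (e.g. `X₁` polarised), `Hg(X₂)` almost `ℚ`-simple and a non-split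
product, `𝒜(X₁) ≃ₗ⁅ℚ⁆ N₁ × 𝒜(X₂)` with `N₁ = 𝔤₁ = {A | (A 0; 0 0) ∈ 𝒜(X₁ × X₂)}` of dimension `dim K₁°`.
[cite: MoonenZarhin1999LowDim, §3 Lemma (3.6), proof, and (3.1)] [cite: Bourbaki1989LieGroups13, Ch. I §6 no. 4 Cor. (b)] -/
theorem exists_lieIdeal_nonempty_lieEquiv_prod_of_ne_of_almostQSimple [LieAlgebra.HasCentralRadical ℚ (hodgeGroupLieRat Φ₁)]
    (hne : hodgeGroupC (prodPeriod Φ₁ Φ₂) ≠ blockDiagProd (hodgeGroupC Φ₁) (hodgeGroupC Φ₂)) :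
    ∃ N₁ : LieIdeal ℚ (hodgeGroupLieRat Φ₁),
      (∀ A : hodgeGroupLieRat Φ₁, A ∈ N₁ ↔
        fromBlocks (A : Matrix ι₁ ι₁ ℚ) 0 0 (0 : Matrix ι₂ ι₂ ℚ) ∈ hodgeGroupLieRat (prodPeriod Φ₁ Φ₂)) ∧
      finrank ℚ N₁ = (isZConnected_identityComponent (isAlgebraicSubgroup_map_toGL_hodgeGroupCProdInl Φ₁ Φ₂)).zdim ∧
      Nonempty (hodgeGroupLieRat Φ₁ ≃ₗ⁅ℚ⁆ (N₁ × hodgeGroupLieRat Φ₂)) :=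
  exists_lieIdeal_nonempty_lieEquiv_prod_of_finite_hodgeGroupCProdInr Φ₁ Φ₂
    (finite_hodgeGroupCProdInr_of_ne_of_almostQSimple Φ₁ Φ₂ hQ hne)

/-- **Gordon's graph alternative with an almost `ℚ`-simple partner**: `𝒜(X₁)` a `ℚ`-simple Lie algebra, `Hg(X₂)` almost `ℚ`-simple
(`dim X₂ > 0`), non-split ⟹ `𝒜(X₁) ≃ₗ⁅ℚ⁆ 𝒜(X₂)`. [cite: Gordon1997, §2.16 Proposition, second bullet] [cite: MoonenZarhin1999LowDim, §3 Lemma (3.5), proof] -/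
theorem nonempty_hodgeGroupLieRat_lieEquiv_of_isSimple_of_ne_of_almostQSimple [Nonempty ι₂]
    [LieAlgebra.IsSimple ℚ (hodgeGroupLieRat Φ₁)]
    (hne : hodgeGroupC (prodPeriod Φ₁ Φ₂) ≠ blockDiagProd (hodgeGroupC Φ₁) (hodgeGroupC Φ₂)) :
    Nonempty (hodgeGroupLieRat Φ₁ ≃ₗ⁅ℚ⁆ hodgeGroupLieRat Φ₂) :=
  nonempty_hodgeGroupLieRat_lieEquiv_of_isSimple_left_of_finite_hodgeGroupCProdInr Φ₁ Φ₂
    (finite_hodgeGroupCProdInr_of_ne_of_almostQSimple Φ₁ Φ₂ hQ hne)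

/-- Non-split with `Hg(X₂)` almost `ℚ`-simple and `𝒜(X₁)` ABELIAN ⟹ `𝒜(X₂)` abelian (a quotient of `𝒜(X₁)`; «in particular `X₂` is of
CM-type» whenever `X₁` is and the product does not split). [cite: MoonenZarhin1999LowDim, §3 Lemma (3.6)] [cite: Bourbaki1989LieGroups13, Ch. I §1 no. 1] -/
theorem isLieAbelian_hodgeGroupLieRat_of_ne_of_almostQSimple [IsLieAbelian (hodgeGroupLieRat Φ₁)]
    (hne : hodgeGroupC (prodPeriod Φ₁ Φ₂) ≠ blockDiagProd (hodgeGroupC Φ₁) (hodgeGroupC Φ₂)) :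
    IsLieAbelian (hodgeGroupLieRat Φ₂) :=
  isLieAbelian_hodgeGroupLieRat_of_finite_hodgeGroupCProdInr Φ₁ Φ₂ (finite_hodgeGroupCProdInr_of_ne_of_almostQSimple Φ₁ Φ₂ hQ hne)

variable {Φ₁} {η₁ : E₁ [⋀^Fin 2]→L[ℝ] ℝ}

/-- **MOONEN–ZARHIN LEMMA (3.6) OVER `ℚ`, THE TORUS CASE: «the center of `Hg(X₁)` contains an algebraic torus which is `ℚ`-isogenous
to `Hg(X₂)`»** read on the rational Lie algebras — `X₁` polarised, `𝒜(X₂)` solvable (abelian: `Hg(X₂)` a torus), `Hg(X₂)` almost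
`ℚ`-simple, `Hg(X₁ × X₂) ≠ Hg(X₁) × Hg(X₂)` ⟹ an INJECTIVE homomorphism of rational Lie algebras `𝒜(X₂) ↪ 𝔷(𝒜(X₁))`.
[cite: MoonenZarhin1999LowDim, §3 Lemma (3.6)] [cite: Bourbaki1989LieGroups13, Ch. I §6 no. 4 Prop. 5] -/
theorem IsRiemannForm.exists_injective_lieHom_center_hodgeGroupLieRat_of_ne_of_almostQSimple (hη₁ : IsRiemannForm Φ₁ η₁)
    [LieAlgebra.IsSolvable (hodgeGroupLieRat Φ₂)]
    (hne : hodgeGroupC (prodPeriod Φ₁ Φ₂) ≠ blockDiagProd (hodgeGroupC Φ₁) (hodgeGroupC Φ₂)) :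
    ∃ j : hodgeGroupLieRat Φ₂ →ₗ⁅ℚ⁆ LieAlgebra.center ℚ (hodgeGroupLieRat Φ₁), Injective j :=
  hη₁.exists_injective_lieHom_center_hodgeGroupLieRat_of_finite_hodgeGroupCProdInr Φ₂
    (ComplexTorus.finite_hodgeGroupCProdInr_of_ne_of_almostQSimple Φ₁ Φ₂ hQ hne)

/-- … hence `dim_ℚ 𝒜(X₂) ≤ dim_ℚ 𝔷(𝒜(X₁))` («an algebraic torus … `ℚ`-isogenous to `Hg(X₂)`» inside `Z(Hg(X₁))`).
[cite: MoonenZarhin1999LowDim, §3 Lemma (3.6)] -/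
theorem IsRiemannForm.finrank_hodgeGroupLieRat_le_finrank_center_of_ne_of_almostQSimple (hη₁ : IsRiemannForm Φ₁ η₁)
    [LieAlgebra.IsSolvable (hodgeGroupLieRat Φ₂)]
    (hne : hodgeGroupC (prodPeriod Φ₁ Φ₂) ≠ blockDiagProd (hodgeGroupC Φ₁) (hodgeGroupC Φ₂)) :
    finrank ℚ (hodgeGroupLieRat Φ₂) ≤ finrank ℚ (LieAlgebra.center ℚ (hodgeGroupLieRat Φ₁)) :=
  hη₁.finrank_hodgeGroupLieRat_le_finrank_center_of_finite_hodgeGroupCProdInr Φ₂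
    (ComplexTorus.finite_hodgeGroupCProdInr_of_ne_of_almostQSimple Φ₁ Φ₂ hQ hne)

/-- **PROP. (3.8)'S «EMBEDDING OF `k` INTO THE CENTER OF `End⁰(X)`», INFINITESIMALLY, FOR AN ALMOST `ℚ`-SIMPLE CM FACTOR**: `X₁` polarised,
`𝒜(X₂)` solvable, `Hg(X₂)` almost `ℚ`-simple, non-split ⟹ an injective `ℚ`-linear `j : 𝒜(X₂) ↪ M(ℚ)` with values in
`𝒜(X₁) ∩ End⁰(X₁)`, central in `End⁰(X₁)` and Rosati-ANTISYMMETRIC (`j(W)' = −j(W)`: type-IV centre directions).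
[cite: MoonenZarhin1999LowDim, §3 Lemma (3.6) and Prop. (3.8)] [cite: Lange2023AbelianVarietiesComplex, §7.2.2 Prop. 7.2.5 and §5.5] -/
theorem IsRiemannForm.exists_injective_linearMap_mem_endAlgRat_of_ne_of_almostQSimple (hη₁ : IsRiemannForm Φ₁ η₁)
    [LieAlgebra.IsSolvable (hodgeGroupLieRat Φ₂)]
    (hne : hodgeGroupC (prodPeriod Φ₁ Φ₂) ≠ blockDiagProd (hodgeGroupC Φ₁) (hodgeGroupC Φ₂)) :
    ∃ j : hodgeGroupLieRat Φ₂ →ₗ[ℚ] Matrix ι₁ ι₁ ℚ, Injective j ∧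
      ∀ W, j W ∈ hodgeGroupLieRat Φ₁ ∧ j W ∈ endAlgRat Φ₁ ∧ (∀ C ∈ endAlgRat Φ₁, j W * C = C * j W) ∧
        ∀ G₀ : Matrix ι₁ ι₁ ℚ, G₀.map ((↑) : ℚ → ℝ) = latticeGram Φ₁ η₁ → rosati G₀ (j W) = -(j W) :=
  hη₁.exists_injective_linearMap_mem_endAlgRat_of_finite_hodgeGroupCProdInr Φ₂
    (ComplexTorus.finite_hodgeGroupCProdInr_of_ne_of_almostQSimple Φ₁ Φ₂ hQ hne)

/-- **SPLITTING CRITERION (Lemma (3.6) contrapositively): `X₁` polarised, `𝒜(X₂)` solvable, `Hg(X₂)` almost `ℚ`-simple and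
`dim_ℚ 𝔷(𝒜(X₁)) < dim_ℚ 𝒜(X₂)` ⟹ `Hg(X₁ × X₂)(ℂ) = Hg(X₁)(ℂ) × Hg(X₂)(ℂ)`** (the centre of `Hg(X₁)` is too small to contain a torus
isogenous to `Hg(X₂)`). [cite: MoonenZarhin1999LowDim, §3 Lemma (3.6)] [cite: Lange2023AbelianVarietiesComplex, §7.2.3 Prop. 7.2.6] -/
theorem IsRiemannForm.hodgeGroupC_prod_eq_blockDiagProd_of_almostQSimple_of_finrank_center_lt (hη₁ : IsRiemannForm Φ₁ η₁)
    [LieAlgebra.IsSolvable (hodgeGroupLieRat Φ₂)]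
    (hlt : finrank ℚ (LieAlgebra.center ℚ (hodgeGroupLieRat Φ₁)) < finrank ℚ (hodgeGroupLieRat Φ₂)) :
    hodgeGroupC (prodPeriod Φ₁ Φ₂) = blockDiagProd (hodgeGroupC Φ₁) (hodgeGroupC Φ₂) := by
  by_contra hne
  exact absurd (hη₁.finrank_hodgeGroupLieRat_le_finrank_center_of_ne_of_almostQSimple Φ₂ hQ hne) (not_le.2 hlt)

/-- Real points of the torus-case criterion: `dim_ℚ 𝔷(𝒜(X₁)) < dim_ℚ 𝒜(X₂)` ⟹ `Hg(X₁ × X₂)(ℝ) = Hg(X₁)(ℝ) × Hg(X₂)(ℝ)`.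
[cite: MoonenZarhin1999LowDim, §3 Lemma (3.6)] -/
theorem IsRiemannForm.hodgeGroup_prod_eq_of_almostQSimple_of_finrank_center_lt (hη₁ : IsRiemannForm Φ₁ η₁)
    [LieAlgebra.IsSolvable (hodgeGroupLieRat Φ₂)]
    (hlt : finrank ℚ (LieAlgebra.center ℚ (hodgeGroupLieRat Φ₁)) < finrank ℚ (hodgeGroupLieRat Φ₂)) :
    hodgeGroup (prodPeriod Φ₁ Φ₂) = ((hodgeGroup Φ₁).prod (hodgeGroup Φ₂)).map (blockDiag ι₁ ι₂) :=
  hodgeGroup_prod_eq_of_hodgeGroupC_prod_eq (hη₁.hodgeGroupC_prod_eq_blockDiagProd_of_almostQSimple_of_finrank_center_lt Φ₂ hQ hlt)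

/-- (D)-transfer: `X₁` polarised and stably nondegenerate, `X₂` stably nondegenerate with `𝒜(X₂)` solvable and `Hg(X₂)` almost
`ℚ`-simple, `dim_ℚ 𝔷(𝒜(X₁)) < dim_ℚ 𝒜(X₂)` ⟹ `X₁ × X₂` is stably nondegenerate. [cite: MoonenZarhin1999LowDim, §3 Thm. (3.2)(2) and Lemma (3.6)]
[cite: Hazama1983, Lemma (3.1)] -/
theorem IsRiemannForm.forall_divisorClasses_powPeriod_prod_eq_hodgeClasses_of_almostQSimple_of_finrank_center_lt
    (hη₁ : IsRiemannForm Φ₁ η₁) [LieAlgebra.IsSolvable (hodgeGroupLieRat Φ₂)]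
    (hlt : finrank ℚ (LieAlgebra.center ℚ (hodgeGroupLieRat Φ₁)) < finrank ℚ (hodgeGroupLieRat Φ₂))
    (hX₁ : ∀ k p, divisorClasses (powPeriod Φ₁ k) p = hodgeClasses (powPeriod Φ₁ k) p)
    (hX₂ : ∀ k p, divisorClasses (powPeriod Φ₂ k) p = hodgeClasses (powPeriod Φ₂ k) p) :
    ∀ k p, divisorClasses (powPeriod (prodPeriod Φ₁ Φ₂) k) p = hodgeClasses (powPeriod (prodPeriod Φ₁ Φ₂) k) p :=
  forall_divisorClasses_powPeriod_prod_eq_hodgeClasses_of_hodgeGroupC_prod_eq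
    (hη₁.hodgeGroupC_prod_eq_blockDiagProd_of_almostQSimple_of_finrank_center_lt Φ₂ hQ hlt) hX₁ hX₂

end Consequences

end ComplexTorus

end Literature.Geometry.Kaehler
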